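/-
Origin: expansion seat `planner-pub-hodgecm-prl2-g7-0`, handover #3 2026-08-18T13:31Z md5 119d9141 (NEW leaf; ONE rewrite: import Prl2g7.JunctionS1S2 -> import HodgeCM.StubTree.JunctionS1S2; lands AFTER #2; HOLD iff #2 held/dropped; fallback DROP) (`HOME/pub-hodgecm-prl2-g7/lean/Prl2g7/JunctionAllCharsTransport.lean`, md5 119d9141, 118 lines);
landed by the gen-8 packager in gate run 30 as `HodgeCM/StubTree/JunctionAllCharsTransport.lean` (import ^import Prl2g7\.JunctionS1S2[ \t]*$→import HodgeCM.StubTree.JunctionS1S2 ×1).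
-/
/-
Copyright (c) 2026. All rights reserved.
Released under Apache 2.0 license as described in the file LICENSE.
Authors: expansion seat `planner-pub-hodgecm-prl2-g7-0` (unit `pub-hodgecm-prl2-g7`, EXPANSION prover a-2, gen 7).
Target `HodgeCM/StubTree/JunctionAllCharsTransport.lean` (NEW additive leaf; one import rewrite `Prl2g7.JunctionS1S2`
↦ `HodgeCM.StubTree.JunctionS1S2`, this lineage's RUN-30 row #2; nothing imports this file).
-/
import Summits.HodgeConjecture.HodgeCM.StubTree.JunctionS1S2

/-!
# The strategy-2 packages are invariant under `ThetaModel.allChars`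

`T.allChars` (prl1-g6, `HodgeCM.Automorphic.SignRecipeEndStateAllChars`) changes ONLY the allowed-character sets of
the two torus sides; strategy 2's inputs `IsoEmbFace/PerL Hk T` and `BMMGlueFace/PerL T` never read them.  The first
pair is invariant DEFINITIONALLY; for the second the `T`-indexed structure types `BMMDict.Standard T` and
`ThetaModel.GoodCtx` are re-packed field by field (exactly as prl1's `allChars_goodCtx_iff`).  Consequence: the
all-characters junction theorems of `JunctionS1S2` hold with strategy 2's binders over the model `T` ITSELF — in
particular over strategy 1's constructed model `C.thetaModel h d12 d34` (no design binder, no `chars` binder, and no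
`allChars` in any hypothesis).  KERNEL only; cites nothing, posits nothing.
-/

noncomputable section

namespace HodgeCM

namespace Universe

variable {U : Universe}

namespace BMMDict

variable {L : CMField} {ι₁ : L →+* ℂ} {V : HermSpace3 L ι₁} (BD : U.BMMDict V) (T : U.ThetaModel)

/-- (Ported verbatim from the HodgeCMPerL package; no docstring in the source.) -/
theorem standard_allChars_iff : BD.Standard T.allChars ↔ BD.Standard T :=
  ⟨fun h => ⟨h.m_eq, h.hab, h.line_real, h.real_inj, h.h10_le, h.theta_sub, h.descent⟩,
    fun h => ⟨h.m_eq, h.hab, h.line_real, h.real_inj, h.h10_le, h.theta_sub, h.descent⟩⟩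

/-- (Ported verbatim from the HodgeCMPerL package; no docstring in the source.) -/
theorem typeMatch_allChars_iff : BD.TypeMatch T.allChars ↔ BD.TypeMatch T := Iff.rfl

/-- (Ported verbatim from the HodgeCMPerL package; no docstring in the source.) -/
theorem signMatch_allChars_iff : BD.SignMatch T.allChars ↔ BD.SignMatch T := Iff.rfl

/-- (Ported verbatim from the HodgeCMPerL package; no docstring in the source.) -/
theorem signForcing_allChars_iff : BD.SignForcing T.allChars ↔ BD.SignForcing T := Iff.rfl

/-- (Ported verbatim from the HodgeCMPerL package; no docstring in the source.) -/
theorem thetaOfLine_allChars_iff : BD.ThetaOfLine T.allChars ↔ BD.ThetaOfLine T :=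
  ⟨fun h c hc => h c ((T.allChars_goodCtx_iff ι₁ c).mpr hc),
    fun h c hc => h c ((T.allChars_goodCtx_iff ι₁ c).mp hc)⟩

/-- (Ported verbatim from the HodgeCMPerL package; no docstring in the source.) -/
theorem lineOfTheta_allChars_iff : BD.LineOfTheta T.allChars ↔ BD.LineOfTheta T :=
  ⟨fun h c hc => h c ((T.allChars_goodCtx_iff ι₁ c).mpr hc),
    fun h c hc => h c ((T.allChars_goodCtx_iff ι₁ c).mp hc)⟩

end BMMDict

/-- The BMM–glue conjunction at one hermitian space is invariant under `allChars`. -/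
theorem bmmGlueAt_allChars_iff (T : U.ThetaModel) {L : CMField} {ι₁ : L →+* ℂ} (V : HermSpace3 L ι₁) :
    (U.UisoDisjoint V ∧ ∃ BD : U.BMMDict V, BD.Standard T.allChars ∧ (∀ Γ, (BD.X Γ).Cor79) ∧
        BD.Homogeneous ∧ BD.TypeMatch T.allChars ∧ BD.SignMatch T.allChars ∧ BD.ThetaOfLine T.allChars ∧
          BD.LineOfTheta T.allChars) ↔
      (U.UisoDisjoint V ∧ ∃ BD : U.BMMDict V, BD.Standard T ∧ (∀ Γ, (BD.X Γ).Cor79) ∧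
        BD.Homogeneous ∧ BD.TypeMatch T ∧ BD.SignMatch T ∧ BD.ThetaOfLine T ∧ BD.LineOfTheta T) :=
  and_congr Iff.rfl (exists_congr fun BD => and_congr (BD.standard_allChars_iff T) (and_congr Iff.rfl
    (and_congr Iff.rfl (and_congr (BD.typeMatch_allChars_iff T) (and_congr (BD.signMatch_allChars_iff T)
      (and_congr (BD.thetaOfLine_allChars_iff T) (BD.lineOfTheta_allChars_iff T)))))))

/-- (Ported verbatim from the HodgeCMPerL package; no docstring in the source.) -/
theorem bmmGlueFace_allChars_iff (T : U.ThetaModel) : U.BMMGlueFace T.allChars ↔ U.BMMGlueFace T :=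
  forall_congr' fun _ => forall_congr' fun _ => forall_congr' fun _ => forall_congr' fun _ =>
    forall_congr' fun _ => forall_congr' fun _ => forall_congr' fun V => bmmGlueAt_allChars_iff T V

/-- (Ported verbatim from the HodgeCMPerL package; no docstring in the source.) -/
theorem bmmGluePerL_allChars_iff (T : U.ThetaModel) : U.BMMGluePerL T.allChars ↔ U.BMMGluePerL T :=
  forall_congr' fun _ => forall_congr' fun _ => forall_congr' fun _ => forall_congr' fun _ =>
    forall_congr' fun _ => forall_congr' fun _ => forall_congr' fun _ => forall_congr' fun _ =>
      forall_congr' fun _ => forall_congr' fun _ => forall_congr' fun _ => forall_congr' fun _ =>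
        forall_congr' fun V => bmmGlueAt_allChars_iff T V

/-- (Ported verbatim from the HodgeCMPerL package; no docstring in the source.) -/
theorem isoEmbFace_allChars_iff (Hk : U.HeckeData) (T : U.ThetaModel) :
    U.IsoEmbFace Hk T.allChars ↔ U.IsoEmbFace Hk T := Iff.rfl

/-- (Ported verbatim from the HodgeCMPerL package; no docstring in the source.) -/
theorem isoEmbPerL_allChars_iff (Hk : U.HeckeData) (T : U.ThetaModel) :
    U.IsoEmbPerL Hk T.allChars ↔ U.IsoEmbPerL Hk T := Iff.rfl

variable (U)

/-- **COR-CM by strategy 2's print route, all-characters theta inputs, binders over `T` itself** (no `chars`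
binder, no `allChars` in any hypothesis). -/
theorem COR_CM_of_liu_bmmGlue_allChars' (M : U.ModelAxioms) (hV : U.Fact_virtualCup11₂) (hL : U.LiuSupplyFace)
    {T : U.ThetaModel} (h₂ : T.Fact_innerEmb) (h₅ : T.Open_thetaSub) (h₇ : T.Open_thetaGen12All)
    (h₈ : T.Open_thetaReal34All) (h₁₀ : T.Open_occ) (hHR : U.Fact_hodgeRiemann20)
    (hκ : T.Design_kappaConj) (hs : T.Design_frameSignConj)
    {Hk : U.HeckeData} (hD : U.IsoEmbFace Hk T) (hX : U.BMMGlueFace T)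
    (hPo : U.PohlmannSpan) (hQ : U.Qw8Sufficiency) : U.HC_CM :=
  U.COR_CM_of_liu_bmmGlue_allChars M hV hL h₂ h₅ h₇ h₈ h₁₀ hHR hκ hs ((isoEmbFace_allChars_iff Hk T).mpr hD)
    ((bmmGlueFace_allChars_iff T).mpr hX) hPo hQ

/-- **PerL by strategy 2's print route, all-characters theta inputs, binders over `T` itself.** -/
theorem perL_of_liu_bmmGlue_allChars' (M : U.ModelAxioms) (hV : U.Fact_virtualCup11₂) (hL : U.LiuSupplyPerL)
    {T : U.ThetaModel} (h₂ : T.Fact_innerEmb) (h₅ : T.Open_thetaSub) (h₇ : T.Open_thetaGen12All)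
    (h₈ : T.Open_thetaReal34All) (h₁₀ : T.Open_occ) (hHR : U.Fact_hodgeRiemann20)
    (hκ : T.Design_kappaConj) (hs : T.Design_frameSignConj)
    {Hk : U.HeckeData} (hD : U.IsoEmbPerL Hk T) (hX : U.BMMGluePerL T) : U.PerL :=
  U.perL_of_liu_bmmGlue_allChars M hV hL h₂ h₅ h₇ h₈ h₁₀ hHR hκ hs ((isoEmbPerL_allChars_iff Hk T).mpr hD)
    ((bmmGluePerL_allChars_iff T).mpr hX)

/-- **The two strategies' end states composed over ONE model term**: strategy 1's all-characters record of its
constructed model `C.thetaModel h d12 d34` and strategy 2's two packages over THE SAME model give `HC_CM` — no design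
binder, no `chars` binder, no `allChars`. -/
theorem COR_CM_of_liu_bmmGlue_ofAllCharsNonDesign' (M : U.ModelAxioms) (hV : U.Fact_virtualCup11₂)
    (hL : U.LiuSupplyFace) (h : Bool) (C : U.AdelicThetaCore₀)
    (d12 d34 : ∀ {L : CMField}, SeesawCtx L → SideData L) (A : (C.thetaModel h d12 d34).AllCharsNonDesign)
    (hHR : U.Fact_hodgeRiemann20) {Hk : U.HeckeData} (hD : U.IsoEmbFace Hk (C.thetaModel h d12 d34))
    (hX : U.BMMGlueFace (C.thetaModel h d12 d34)) (hPo : U.PohlmannSpan) (hQ : U.Qw8Sufficiency) : U.HC_CM :=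
  U.COR_CM_of_liu_bmmGlue_allChars' M hV hL A.innerEmb A.thetaSub A.thetaGen12All A.thetaReal34All A.occ hHR
    (C.design_kappaConj h d12 d34) (C.design_frameSignConj h d12 d34) hD hX hPo hQ

end Universe

end HodgeCM

end
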